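import Literature.Barriers.MatrixMultiplication.UniversalMethodBarrierCor28
import Literature.Barriers.MatrixMultiplication.UniversalMethodBarrierCwNumerics
import HarnessLib

/-!
# `UniversalMethodBarrier` holds — assembly (Alman 2021, Thm. 2.9 ∧ Cor. 2.8 ∧ Thm. 1.3)

Topic `Literature/Barriers/MatrixMultiplication`; DISCHARGE of the catalogue entry / named fact
`UniversalMethodBarrier` (`UniversalMethodBarrier.lean`): the conjunction of `Alman2021_thm29`
(proved in `UniversalMethodBarrierThm29.lean`), `Alman2021_cor28` (`UniversalMethodBarrierCor28.lean`)
and `Alman2021_thm13` (`UniversalMethodBarrierCwNumerics.lean`). Sorry-free; axioms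
`propext, Classical.choice, Quot.sound` only. The proof files, in dependency order:
`…SliceRank`, `…Degeneration`, `…DegenerationPow`, `…DegenerationSliceRank` (Prop. 2.3),
`…Products`, `…MatMul` (Strassen's diagonal, Prop. 2.5/Cor. 2.6), `…Thm29`;
`Computability/AlgebraicComplexity/FlatteningRank`, `…AsymptoticRank`, `…Cor28`;
`…CwCount` (finite Thm. 3.4 for `CW_q`), `…CwCore`, `…CwTangent`, `…CwNumerics` (Thm. 1.3).

## References

* J. Alman, *Limits on the Universal Method for Matrix Multiplication*, Theory of Computing 17
  (2021) 1–30, Thm. 1.3, Thm. 2.9, Cor. 2.8 (held: `doi-10-4086-toc-2021-v017a001`). [Alman2021]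
-/

noncomputable section

namespace Literature.Barriers.MatrixMultiplication

/-- **The catalogue entry `UniversalMethodBarrier` is a theorem** — DISCHARGE of the named fact:
Alman 2021, Thm. 2.9 (`Alman2021_thm29_holds`), Cor. 2.8 (`Alman2021_cor28_holds`) and Thm. 1.3
(`Alman2021_thm13_holds`), all proved sorry-free in the sibling files. [cite: Alman2021, Thm. 1.3] -/
theorem UniversalMethodBarrier_holds : UniversalMethodBarrier :=
  ⟨Alman2021_thm29_holds, Alman2021_cor28_holds, Alman2021_thm13_holds⟩

end Literature.Barriers.MatrixMultiplication

end
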